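import Mathlib
import HarnessLib
import HarnessLib.Audit
import Summits.MatrixMultiplication.Statement
import Literature.Computability.AlgebraicComplexity.AsymptoticSpectrum
import Literature.Computability.AlgebraicComplexity.MatrixMultiplicationExponent
import Literature.Computability.AlgebraicComplexity.QuantumFunctionalPoint
import Summits.MatrixMultiplication.MatrixMultiplication.Theorems.AsymptoticRankCWOmegaGeTwo

/-!
Route: AsymptoticSpectrum

X_A (asymptotic-spectrum form of ω = 2): the asymptotic rank of the 2×2 matrix multiplication tensor
is 4,
R~(⟨2,2,2⟩) := lim_N R(⟨2,2,2⟩^{⊗N})^{1/N} = 4. Since ⟨2,2,2⟩^{⊗N} ≅ ⟨2^N,2^N,2^N⟩ this is stated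
over existing
declarations, with no Kronecker-power definition, as: for every ε > 0, R(⟨2^N,2^N,2^N⟩) =
O(4^{(1+ε)N}) (N → ∞).
By Strassen's duality (Strassen1988 Thm 3.8: R~(t) = max_{F ∈ Δ} F(t) over the asymptotic spectrum Δ
of all
3-tensors) X_A says: every universal spectral point F (monotone semiring homomorphism, F(⟨1⟩)=1) has
F(⟨2,2,2⟩) ≤ 4.

Lean (elaborates, Sketch.lean):
∀ ε : ℝ, 0 < ε → (fun N : ℕ => (Literature.Computability.AlgebraicComplexity.tensorRank
(Literature.Computability.AlgebraicComplexity.matMulTensor ℂ (2 ^ N) (2 ^ N) (2 ^ N)) : ℝ))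
=O[Filter.atTop] fun N : ℕ => (4 : ℝ) ^ ((1 + ε) * N)

Rationale: WHY THIS LINE (widen: spectral/functional-analytic reformulation + quantum information).
Strassen1988 (Thm 3.8, quoted in
ChristandlVranaZuiddam2023 = arXiv:1709.07851 p7) turns asymptotic rank into a maximum over the
compact space Δ of universal
spectral points (Stone–Kadison–Dubois representation of the preordered semiring of tensors). ω = 2 ⟺
R~(⟨2,2,2⟩) = 4 ⟺
max_{F∈Δ} F(⟨2,2,2⟩) = 4. All KNOWN points of Δ over ℂ — gauge points (flattening ranks) and the
quantum functionals F^θ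
built from moment/entanglement polytopes (arXiv:1709.07851, Thm 1.1 + §3) — take the value ≤ 4 on
⟨2,2,2⟩ (F^θ ≤ max
flattening rank). So the route is: describe Δ(ℂ) well enough (invariant theory of moment polytopes,
quantum Shannon theory)
to certify that NO spectral point exceeds the flattening value on ⟨2,2,2⟩. Imports: representation
theory of GL×GL×GL and
S_N (moment polytopes), real semi-algebraic/functional analysis (spectrum of a Strassen preorder).
This is a superset of
PROBLEMS.md §3 "Strassen asymptotic rank conjecture → ω = 2", localised at the single tensor
⟨2,2,2⟩.

RANKED CRUXES
rank 2  [informal] every universal spectral point F of complex 3-tensors satisfies F(⟨2,2,2⟩) ≤ 4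
(equivalently ≤ the
        maximal flattening rank on ⟨2,2,2⟩). Hardest; by Strassen duality it is X_A itself in dual
clothing, but it is the
        form in which partial results exist (F^θ, support functionals) and in which a refutation
would be exhibited.
rank 3  [informal] universality: the quantum functionals {F^θ : θ ∈ P([3])} ARE all of Δ for complex
3-tensors
        (open question of arXiv:1709.07851; implies rank 2 and Strassen's asymptotic rank conjecture
for all tensors).
        Its negation is filed too (a non-quantum universal spectral point) — informative either way.
rank 4  [sig] Kronecker submultiplicativity R(⟨nm,nm,nm⟩) ≤ R(⟨n,n,n⟩)·R(⟨m,m,m⟩) over any field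
(Blaser2013 §5/§7,
        BurgisserClausenShokrollahi1997 Prop 14.23) — needed to pass between ⟨2,2,2⟩^{⊗N} and ⟨2^N⟩
and for Fekete.
rank 5  [sig] monotonicity R(⟨n,n,n⟩) ≤ R(⟨m,m,m⟩) for n ≤ m (restriction/padding) — interpolates
2^N ≤ n < 2^{N+1}.
rank 6  [sig] BddBelow(admissibleExponents ℂ) ∧ 2 ≤ ω(ℂ) (flattening bound R(⟨n,n,n⟩) ≥ n²;
Blaser2013 §5) — shared
        with every positive route; makes sInf a genuine infimum.
Assembly (#1): X_A + rank 4,5,6 ⇒ ω(ℂ) = 2 (ε-bookkeeping only).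

FACTS WANTED AS HYPOTHESES (cite items): Strassen duality (Strassen1988 Thm 3.8); quantum
functionals are universal
spectral points and F^θ ≤ flattening ranks (arXiv:1709.07851 Thm 1.1/§3); Δ invariant under field
extension (Str88 3.10).
DEFINITIONS WANTED: kroneckerTensor (⊗ of coordinate 3-tensors), tensorRestrictsTo (≤),
asymptoticRank R~,
IsUniversalSpectralPoint / asymptoticSpectrum, quantumFunctional (ℂ only).

KILL CRITERIA: a universal spectral point F with F(⟨2,2,2⟩) > 4 (⟺ ω > 2; closes every positive
route); a proof that
R~(⟨2,2,2⟩) ≥ 4+δ from any superquadratic border-rank lower bound (route BorderRankLowerBound). Rank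
3 refuted alone
does NOT close the route (pivot to rank 2 directly).
NOT DECOMPOSED YET: structure theory of Δ(ℂ) beyond F^θ; higher-order (k>3) spectra; the
moment-polytope computation
for ⟨2,2,2⟩^{⊗N}; any laser-method content (that is route AsymptoticRankCW).

Novelty: Searches (2026-08-15): `lit search "asymptotic rank conjecture"` (25 local docs: arXiv:1811.05511,
arXiv:2411.15789,
arXiv:2311.02774, arXiv:2601.08119, arXiv:2004.01492 Conj 8.8; remote 66 merged: arXiv:2310.11926,
arXiv:2404.06427,
arXiv:2404.04987); `lit read arxiv:1709.07851 --grep` (Rem 4.6: Strassen's Conj [MR1341854]; Rem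
4.23), `lit read
arxiv:1811.05511` (§1.2 hierarchy, Def. p. 3, p. 13 spectral form), `lit read arxiv:2411.15789` (p.
3), `lit read
arxiv:2604.18283` (2026: unknown universal points exist for k ≥ 4; k = 3 open), `lit frontier
MatrixMultiplication --since
2023` (30 rows; doi:10.1090/bull/1880 Wigderson–Zuiddam survey not held → acq-01347), `lit bridges
MatrixMultiplication
--cross any` (30 rows, none spectral), `lit galaxy search "asymptotic spectrum of tensors" --star
all` (20 rows: BCLSZ
Discreteness ITCS 2024, Kopparty–Moshkovitz–Zuiddam geometric rank), `lean search` (no route types a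
format bound on all
of Δ(ℂ); gaugePoint/flatteningRank statements only in AsymptoticRankCW/CartanCubic/NonabelianARC
prose), `ledger negatives
--problem MatrixMultiplication` (0).
Nearest prior art found: arXiv:1811.05511 (ConnerGesmundoLandsbergVenturaWang2020: the hierarchy
Conj 1.3 ⇐ 1.4 ⇐ Q1.7 and
its spectral rephrasing p. 13), BurgisserClausenShokrollahi1997 (Problem 15.5; Ex 15.24(4)
R̃(⟨2,2,2⟩) = 2^ω),
ChristandlVranaZuiddam2023 (Prop 1.6 duality, Cor 3.31 quantum points), Strassen1988/Strassen1991
(Δ, support functionals);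
in-hub: routes IsotypicSaturation (me  [refs: 10.1090/bull/1880, 1811.05511, 2411.15789, 2311.02774, 2601.08119, 2004.01492, 2310.11926, 2404.06427, 2404.04987, 1709.07851, 2604.18283, arxiv:1709.07851, arxiv:1811.05511, arxiv:2411.15789, arxiv:2604.18283, doi:10.1090/bull/1880, ConnerGesmundoLandsbergVenturaWang2020, BurgisserClausenShokrollahi1997, ChristandlVranaZuiddam2023, Strassen1988, Strassen1991]

Barriers (technique_class: asymptotic-spectrum, spectral-duality, ARC): - technique_class: asymptotic-spectrum, spectral-duality, ARC
- Literature.Barriers.MatrixMultiplication.IrreversibilityBarrier: n/a to the assembly — no fixed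
intermediate tensor is powered and degenerated; but it constrains HOW a rung can be proved: a proof
of ASpectralBound by exhibiting restrictions through CW-type tensors is barred (i(CW_q) > 1), so the
bet is a non-constructive description of Δ(ℂ) (compactness / spectral theorem), not an algorithm.
- Literature.Barriers.MatrixMultiplication.UniversalMethodBarrier: n/a for the same reason
(ω_u(CW_q) ≥ 2.16805 bounds the universal method on CW_q; the route bounds functionals, not
constructions); conceded that any proof of a rung implies ω = 2 and hence must implicitly beat every
such method.
- Literature.Barriers.MatrixMultiplication.UnstableTensorBarrier: n/a — no starting tensor; ⟨2,2,2⟩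
itself is semistable/1-generic and the rungs quantify over all tensors.
- Literature.Barriers.MatrixMultiplication.InfimumNotMinimumBarrier: respected — X_A carries the ε,
R̃ is an infimum, ω enters only through R̃(⟨2,2,2⟩) = 2^ω; no exact attainment by a finite algorithm
is asserted.
- Literature.Barriers.MatrixMultiplication.LinearRankMethodBarrier: bears on the REFUTATION side
only: a dark point cannot be a linear-rank/flattening functional (gauge points read 4 at ⟨2,2,2⟩;
rank methods cap at ≈ 6m − 4), so ¬ASpectralBound needs a genuinely nonlinear ⊗-multiplicative
monotone — which is why no cheap falsifier exists.
- Literature.Barr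

sub-problem: MatrixMultiplication · status: done · opened planner-MatrixMultiplication-Survey-0 2026-08-13T13:15:18Z · rev 3 · ledger route-MatrixMultiplication-AsymptoticSpectrum
GENERATED by the gate from the ledger (D-0016/17). Provers cite these decls: `theorem foo : Summit.MatrixMultiplication.MatrixMultiplication.Theses.AsymptoticSpectrum.<Decl> := …` in Summits/MatrixMultiplication/MatrixMultiplication/Theorems/<Name>.lean.
-/

namespace Summit.MatrixMultiplication.MatrixMultiplication.Theses.AsymptoticSpectrum

open scoped BigOperators Topology Manifold Classical MeasureTheory ProbabilityTheory Matrix InnerProductSpace ComplexConjugate ContinuousMap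
open Filter Set Function TopologicalSpace MeasureTheory

attribute [summit_statement] _root_.MatrixMultiplication

/-- item stmt-MatrixMultiplication-0579 · target · rank 0 · open · by planner
why it might fail: X_A is ω(ℂ) = 2 itself (Assembly proved in tree): the record is ω ≤ 2.371552, every upper-bound method in use is barred away from 2 (ω_u(CW_q) ≥ 2.16805, Alman2021; irreversibility, ChristandlVranaZuiddam2021), and ω > 2 is widely suspected.
sources: Blaser2013, BurgisserClausenShokrollahi1997, Alman2021, ChristandlVranaZuiddam2021, arXiv:2411.15789
X_A: asymptotic rank of <2,2,2> is 4, i.e. for every eps>0, R(<2^N,2^N,2^N>) = O(4^{(1+eps)N}) over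
C (equivalently every universal spectral point F has F(<2,2,2>) <= 4, Strassen1988 Thm 3.8). -/
@[route_item "route-MatrixMultiplication-AsymptoticSpectrum"]
def AThesis : Prop :=
  ∀ ε : ℝ, 0 < ε → (fun N : ℕ => (Literature.Computability.AlgebraicComplexity.tensorRank (Literature.Computability.AlgebraicComplexity.matMulTensor ℂ (2 ^ N) (2 ^ N) (2 ^ N)) : ℝ)) =O[Filter.atTop] fun N : ℕ => (4 : ℝ) ^ ((1 + ε) * N)

-- TODO item stmt-MatrixMultiplication-0581 · crux · rank 2 · open · by planner — BLOCKED: missing decl(s) Literature.CplxAlg.FinTensor, Literature.CplxAlg.Restricts; restate via `ledger route edit` once they land: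
--   def ASpectralBound : Prop := ∀ F : Literature.Computability.AlgebraicComplexity.SpectralMap ℂ, Literature.Computability.AlgebraicComplexity.IsUniversalSpectralPoint ℂ F → F (Literature.Computability.AlgebraicComplexity.matMulTensor ℂ 2 2 2) ≤ 4

/-- item stmt-MatrixMultiplication-8614 · crux · rank 3 · open · by planner
why it might fail: Open since Strassen 1988/94 already at cw₂ ≅ T₁ ∈ ℂ³⊗ℂ³⊗ℂ³ (tight; 3 ≤ R̃ < 3.931, AlmanLi2026; Kronecker square bR-multiplicative, ConnerHuangLandsberg2020); implies ω = 2 and REFUTES the Set Cover Conjecture (Pratt2024SCC: tight concise T_k), so one of two believed conjectures dies.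
sources: arXiv:1811.05511, Strassen1991, Pratt2024SCC, AlmanLi2026, ConnerHuangLandsberg2020, ChristandlVranaZuiddam2023
[crux] STRASSEN'S ASYMPTOTIC RANK CONJECTURE, spectral form: for every universal spectral point F
over ℂ and every finite 3-tensor t whose support is tight in the given bases (injective ℤ-labels a,
b, c with a i + b j + c k = 0 on supp t; CGLVW Def. p. 3), F t ≤ max of the three format
cardinalities (CGLVW Conj 1.4 / p. 13; Strassen 1994 Conj 5.3 ⇒ it). ⟨2,2,2⟩ is tight, so it implies
ASpectralBound (glue TightToSpectralBound). [difficulty: open-problem] (why it might fail: Open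
since Strassen 1988/94 already at cw₂ ≅ T₁ ∈ ℂ³⊗ℂ³⊗ℂ³ (tight; 3 ≤ R̃ < 3.931, AlmanLi2026; Kronecker
square bR-multiplicative, ConnerHuangLandsberg2020); implies ω = 2 and REFUTES the Set Cover
Conjecture (Pratt2024SCC: tight concise T_k), so one of two believed conjectures dies.)
[arXiv:1811.05511, Strassen1991, Pratt2024SCC, AlmanLi2026, ConnerHuangLandsberg2020,
ChristandlVranaZuiddam2023] -/
@[route_item "route-MatrixMultiplication-AsymptoticSpectrum"]
def TightFormatBound : Prop :=
  ∀ F : Literature.Computability.AlgebraicComplexity.SpectralMap ℂ, Literature.Computability.AlgebraicComplexity.IsUniversalSpectralPoint ℂ F → ∀ ⦃ι κ μ : Type⦄ [Fintype ι] [Fintype κ] [Fintype μ] (t : ι → κ → μ → ℂ), (∃ (a : ι → ℤ) (b : κ → ℤ) (c : μ → ℤ), Function.Injective a ∧ Function.Injective b ∧ Function.Injective c ∧ ∀ i j k, t i j k ≠ 0 → a i + b j + c k = 0) → F t ≤ max (Fintype.card ι : ℝ) (max (Fintype.card κ : ℝ) (Fintype.card μ : ℝ))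

/-- item stmt-MatrixMultiplication-8616 · crux · rank 4 · open · by planner
why it might fail: Generic t ∈ ℂ^m⊗ℂ^m⊗ℂ^m has border rank ≈ m²/3: needs huge strict submultiplicativity, with only numerical support (bR(T^{⊠2}) ≤ 22 < 25 for generic 3×3×3, arXiv:1811.05511; arXiv:2601.08119); contradicts the Set Cover Conjecture (BjorklundKaski2024); only R̃(t) ≤ m^{2ω/3} is known (Strassen1988).
sources: BurgisserClausenShokrollahi1997, arXiv:1811.05511, arXiv:2411.15789, BjorklundKaski2024, arXiv:2601.08119, Strassen1988
[crux] BCS PROBLEM 15.5, spectral form ("all tensors have minimal asymptotic rank", CGLVW Q1.7;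
"asymptotic rank = largest flattening rank", arXiv:2411.15789 p. 3): for every universal spectral
point F over ℂ and every finite 3-tensor t, F t ≤ max of the three format cardinalities. Implies
TightFormatBound by dropping the hypothesis (glue FormatToTight); implied by AQuantumUniversality
(F^θ ≤ ∏ dims^θ). [difficulty: open-problem] (why it might fail: Generic t ∈ ℂ^m⊗ℂ^m⊗ℂ^m has border
rank ≈ m²/3: needs huge strict submultiplicativity, with only numerical support (bR(T^{⊠2}) ≤ 22 <
25 for generic 3×3×3, arXiv:1811.05511; arXiv:2601.08119); contradicts the Set Cover Conjecture
(BjorklundKaski2024); only R̃(t) ≤ m^{2ω/3} is known (Strassen1988).)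
[BurgisserClausenShokrollahi1997, arXiv:1811.05511, arXiv:2411.15789, BjorklundKaski2024,
arXiv:2601.08119, Strassen1988] -/
@[route_item "route-MatrixMultiplication-AsymptoticSpectrum"]
def FormatBound : Prop :=
  ∀ F : Literature.Computability.AlgebraicComplexity.SpectralMap ℂ, Literature.Computability.AlgebraicComplexity.IsUniversalSpectralPoint ℂ F → ∀ ⦃ι κ μ : Type⦄ [Fintype ι] [Fintype κ] [Fintype μ] (t : ι → κ → μ → ℂ), F t ≤ max (Fintype.card ι : ℝ) (max (Fintype.card κ : ℝ) (Fintype.card μ : ℝ))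

/-- item stmt-MatrixMultiplication-0582 · support · rank 3 · open · by planner
sources: ChristandlVranaZuiddam2023, arXiv:2604.18283, Vrana2023
Universality of the quantum functionals (open problem of ChristandlVranaZuiddam2023 =
arXiv:1709.07851): every universal spectral point of complex 3-tensors equals F^θ for some θ in the
probability simplex P([3]) (F^θ(t) = sup over the moment polytope of t of 2^{Σ θ_i H(λ_i)}). Implies
A_spectral_bound and Strassen asymptotic rank conjecture R~(t) ≤ max flattening rank for all t. -/
@[route_item "route-MatrixMultiplication-AsymptoticSpectrum"]
def AQuantumUniversality : Prop :=
  ∀ F : Literature.Computability.AlgebraicComplexity.SpectralMap ℂ, Literature.Computability.AlgebraicComplexity.IsUniversalSpectralPoint ℂ F → ∃ θ ∈ stdSimplex ℝ (Fin 3), ∀ ⦃ι κ μ : Type⦄ [Fintype ι] [Fintype κ] [Fintype μ] (t : ι → κ → μ → ℂ), F t = Literature.Computability.AlgebraicComplexity.quantumFunctionalPoint θ t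

/-- item stmt-MatrixMultiplication-0583 · support · rank 3 · closed · moot by None · by planner
sources: ChristandlVranaZuiddam2023, arXiv:2604.18283
NEGATION of A_quantum_universality: there is a universal spectral point F of complex 3-tensors and a
tensor t with F(t) ≠ F^θ(t) for every θ ∈ P([3]) (a non-quantum spectral point). If moreover
F(<2,2,2>) > 4 this refutes ω = 2; if F ≤ max flattening rank everywhere it is harmless to X_A. File
as its own target: either answer re-ranks the route. -/
@[route_item "route-MatrixMultiplication-AsymptoticSpectrum"]
def AQuantumUniversalityNeg : Prop :=
  ¬ (∀ F : Literature.Computability.AlgebraicComplexity.SpectralMap ℂ, Literature.Computability.AlgebraicComplexity.IsUniversalSpectralPoint ℂ F → ∃ θ ∈ stdSimplex ℝ (Fin 3), ∀ ⦃ι κ μ : Type⦄ [Fintype ι] [Fintype κ] [Fintype μ] (t : ι → κ → μ → ℂ), F t = Literature.Computability.AlgebraicComplexity.quantumFunctionalPoint θ t)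

/-- item stmt-MatrixMultiplication-0584 · support · rank 4 · open · by planner
sources: BurgisserClausenShokrollahi1997, Blaser2013
Kronecker submultiplicativity for matrix multiplication rank over any field: R(<nm,nm,nm>) ≤
R(<n,n,n>)·R(<m,m,m>) (Blaser2013 §5 with R(t⊗t) ≤ R(t)R(t), BurgisserClausenShokrollahi1997 Prop
14.23; <n,n,n>⊗<m,m,m> ≅ <nm,nm,nm>). -/
@[route_item "route-MatrixMultiplication-AsymptoticSpectrum"]
def AKroneckerSubmult : Prop :=
  ∀ (K : Type) [Field K] (n m : ℕ), Literature.Computability.AlgebraicComplexity.tensorRank (Literature.Computability.AlgebraicComplexity.matMulTensor K (n * m) (n * m) (n * m)) ≤ Literature.Computability.AlgebraicComplexity.tensorRank (Literature.Computability.AlgebraicComplexity.matMulTensor K n n n) * Literature.Computability.AlgebraicComplexity.tensorRank (Literature.Computability.AlgebraicComplexity.matMulTensor K m m m)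

/-- item stmt-MatrixMultiplication-0585 · support · rank 5 · open · by planner
sources: Blaser2013
Monotonicity of matrix multiplication rank in the size over any field: n ≤ m → R(<n,n,n>) ≤
R(<m,m,m>) (<n,n,n> is a restriction of <m,m,m> by zero-padding; Blaser2013 §5). -/
@[route_item "route-MatrixMultiplication-AsymptoticSpectrum"]
def AMonotone : Prop :=
  ∀ (K : Type) [Field K] (n m : ℕ), n ≤ m → Literature.Computability.AlgebraicComplexity.tensorRank (Literature.Computability.AlgebraicComplexity.matMulTensor K n n n) ≤ Literature.Computability.AlgebraicComplexity.tensorRank (Literature.Computability.AlgebraicComplexity.matMulTensor K m m m)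

/-- item stmt-MatrixMultiplication-0586 · support · rank 6 · closed · proved by Summit.MatrixMultiplication.MatrixMultiplication.Theorems.omegaGeTwo_proof @ cbdcc04c67d9 (prover) · by planner
sources: Blaser2013, BurgisserClausenShokrollahi1997
Lower frame shared by all positive routes: admissibleExponents ℂ is bounded below and 2 ≤ ω(ℂ), from
the flattening bound R(<n,n,n>) ≥ n^2 (Blaser2013 §5–6; BurgisserClausenShokrollahi1997 (15.?)
conciseness) and n^2 = O(n^β) ⇒ β ≥ 2. -/
@[route_item "route-MatrixMultiplication-AsymptoticSpectrum"]
def OmegaGeTwo : Prop :=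
  BddBelow (Literature.Computability.AlgebraicComplexity.admissibleExponents ℂ) ∧ 2 ≤ Literature.Computability.AlgebraicComplexity.omega ℂ

/-- item stmt-MatrixMultiplication-0587 · support · rank 6 · open · by planner
sources: Blaser2013, BurgisserClausenShokrollahi1997
Flattening (conciseness) lower bound over any field: n^2 ≤ R(<n,n,n>) — the n^2 slices Z_{κν} are
linearly independent bilinear forms (Blaser2013 §4 Rem./§6; BurgisserClausenShokrollahi1997 Ch. 14). -/
@[route_item "route-MatrixMultiplication-AsymptoticSpectrum"]
def FlatteningLowerBound : Prop :=
  ∀ (K : Type) [Field K] (n : ℕ), n ^ 2 ≤ Literature.Computability.AlgebraicComplexity.tensorRank (Literature.Computability.AlgebraicComplexity.matMulTensor K n n n)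

/-- item stmt-MatrixMultiplication-8617 · support · rank 9 · open · by planner
sources: arXiv:1811.05511
[support] glue FormatBound → TightFormatBound (pure logic: drop the tightness hypothesis; proved in
the planner's Sketch.lean). [difficulty: provable-now] [arXiv:1811.05511] -/
@[route_item "route-MatrixMultiplication-AsymptoticSpectrum"]
def FormatToTight : Prop :=
  (∀ F : Literature.Computability.AlgebraicComplexity.SpectralMap ℂ, Literature.Computability.AlgebraicComplexity.IsUniversalSpectralPoint ℂ F → ∀ ⦃ι κ μ : Type⦄ [Fintype ι] [Fintype κ] [Fintype μ] (t : ι → κ → μ → ℂ), F t ≤ max (Fintype.card ι : ℝ) (max (Fintype.card κ : ℝ) (Fintype.card μ : ℝ))) → (∀ F : Literature.Computability.AlgebraicComplexity.SpectralMap ℂ, Literature.Computability.AlgebraicComplexity.IsUniversalSpectralPoint ℂ F → ∀ ⦃ι κ μ : Type⦄ [Fintype ι] [Fintype κ] [Fintype μ] (t : ι → κ → μ → ℂ), (∃ (a : ι → ℤ) (b : κ → ℤ) (c : μ → ℤ), Function.Injective a ∧ Function.Injective b ∧ Function.Injective c ∧ ∀ i j k, t i j k ≠ 0 → a i + b j +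 c k = 0) → F t ≤ max (Fintype.card ι : ℝ) (max (Fintype.card κ : ℝ) (Fintype.card μ : ℝ)))

/-- item stmt-MatrixMultiplication-8618 · support · rank 9 · open · by planner
sources: arXiv:1811.05511, Blaser2013
[support] glue TightFormatBound → ASpectralBound: ⟨2,2,2⟩ = matMulTensor ℂ 2 2 2 is tight in the
standard bases (labels τ_A(κ,ν) = κ + 2ν, τ_B(κ,μ) = −κ + 4μ, τ_C(μ,ν) = −(4μ + 2ν)) and its format
cardinalities are 4 (proved in the planner's Sketch.lean). [difficulty: provable-now]
[arXiv:1811.05511, Blaser2013] -/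
@[route_item "route-MatrixMultiplication-AsymptoticSpectrum"]
def TightToSpectralBound : Prop :=
  (∀ F : Literature.Computability.AlgebraicComplexity.SpectralMap ℂ, Literature.Computability.AlgebraicComplexity.IsUniversalSpectralPoint ℂ F → ∀ ⦃ι κ μ : Type⦄ [Fintype ι] [Fintype κ] [Fintype μ] (t : ι → κ → μ → ℂ), (∃ (a : ι → ℤ) (b : κ → ℤ) (c : μ → ℤ), Function.Injective a ∧ Function.Injective b ∧ Function.Injective c ∧ ∀ i j k, t i j k ≠ 0 → a i + b j + c k = 0) → F t ≤ max (Fintype.card ι : ℝ) (max (Fintype.card κ : ℝ) (Fintype.card μ : ℝ))) → ∀ F : Literature.Computability.AlgebraicComplexity.SpectralMap ℂ, Literature.Computability.AlgebraicComplexity.IsUniversalSpectralPoint ℂ F → F (Literature.Computability.AlgebraicComplexity.matMulTensor ℂ 2 2 2) ≤ 4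

/-- item stmt-MatrixMultiplication-8619 · support · rank 9 · open · by planner
sources: ChristandlVranaZuiddam2023, AlmanDuanVassilevskaWilliamsXuXuZhou2025, Blaser2013
[support] glue ASpectralBound → X_A (cruxes → thesis): duality
`strassen_duality_asymptoticRank_holds` gives R̃(⟨2,2,2⟩) ≤ 4, `asymptoticRank_matMulTensor` gives
2^ω ≤ 4, so ω(ℂ) ≤ 2 = ω by `two_le_omega` (Theorems/AsymptoticSpectrumOmegaGeTwo), and ω = inf of
admissible exponents = 2 yields R(⟨2^N⟩) = O(2^{βN}) ≤ O(4^{(1+ε)N}) for some admissible β < 2 + 2ε.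
[difficulty: provable-now] [ChristandlVranaZuiddam2023, AlmanDuanVassilevskaWilliamsXuXuZhou2025,
Blaser2013] -/
@[route_item "route-MatrixMultiplication-AsymptoticSpectrum"]
def SpectralBoundToThesis : Prop :=
  (∀ F : Literature.Computability.AlgebraicComplexity.SpectralMap ℂ, Literature.Computability.AlgebraicComplexity.IsUniversalSpectralPoint ℂ F → F (Literature.Computability.AlgebraicComplexity.matMulTensor ℂ 2 2 2) ≤ 4) → ∀ ε : ℝ, 0 < ε → (fun N : ℕ => (Literature.Computability.AlgebraicComplexity.tensorRank (Literature.Computability.AlgebraicComplexity.matMulTensor ℂ (2 ^ N) (2 ^ N) (2 ^ N)) : ℝ)) =O[Filter.atTop] fun N : ℕ => (4 : ℝ) ^ ((1 + ε) * N)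

/-- item stmt-MatrixMultiplication-0580 · assembly · rank 1 · open · by planner
X_A → ω(ℂ) = 2: from the 2^N subsequence to all n by monotonicity of R(<n,n,n>) in n (rank-5 item),
plus ω ≥ 2 / BddBelow (rank-6 item); ε-bookkeeping with Real.rpow. -/
@[route_item "route-MatrixMultiplication-AsymptoticSpectrum"]
def Assembly : Prop :=
  (∀ ε : ℝ, 0 < ε → (fun N : ℕ => (Literature.Computability.AlgebraicComplexity.tensorRank (Literature.Computability.AlgebraicComplexity.matMulTensor ℂ (2 ^ N) (2 ^ N) (2 ^ N)) : ℝ)) =O[Filter.atTop] fun N : ℕ => (4 : ℝ) ^ ((1 + ε) * N)) → MatrixMultiplication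

end Summit.MatrixMultiplication.MatrixMultiplication.Theses.AsymptoticSpectrum
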